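import Summits.CriticalPhenomena.PercolationContinuityZ3.Theorems.PercNearOneGluingNoHeavyLowerTailOrderedDifferences
import Summits.CriticalPhenomena.PercolationContinuityZ3.Theorems.PercNearOneGluingNoHeavyLowerTailJBernSunflowerKleitmanTwoPetalIC
import HarnessLib

/-!
# `NoHeavyLowerTail` (crux stmt-CriticalPhenomena-4575), hull-port line hp-7: two petals, both orientations, CO-INTERSECTING families —
# Theorem A sharpened, in three lines from prim-ineq-gen-3's two-family Marica–Schönheim inequality `MS2′`

Support file (prover `prim-hp-7`, generation 50; `--supports stmt-CriticalPhenomena-4575`).  No definitions, no `sorry`, standard axioms.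
Memo: `prim-hp-7/FROM-prim-hp-7-g50-IC-KLEITMAN.md` §0 (S0, S3), §7(f).

`…JBernSunflowerKleitmanTwoPetalIC` (this seat, p301402) proved by FOLDING: for up-sets `U₁, U₂` and a family `S` of antipodal middle pairs of either orientation
(`ζ ∈ U₁∖U₂, univ∖ζ ∈ U₂∖U₁` or the reverse) that is intersecting AND co-intersecting, `#(S ∩ 𝒰) ≤ #(targets ∩ 𝒰)` for every up-set `𝒰`.  Here the hypothesis
'intersecting' is DROPPED: co-intersection (`ζ ∪ ξ ≠ univ`) alone suffices (`JBern.card_filter_le_card_filter_target_of_union_ne_univ`), and the proof is the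
Marica–Schönheim route of prim-ineq-gen-3 (`…OrientedAntipodalHall`, gen 3; their Conjecture O_k excludes the opposite pair of types treated here): with
`𝒞 = {univ∖a : a of type (1,2)}` and `ℬ = {ξ : ξ of type (2,1)}` the complements of the members of `(𝒞 \\ 𝒞) ∪ (𝒞 \\ ℬ) ∪ (ℬ \\ ℬ)` — the sets `a ∪ (univ∖a′)`, `a ∪ ξ`,
`ξ′ ∪ (univ∖ξ)` — are targets lying above a member of the family, and `#𝒞 + #ℬ ≤ #((𝒞 \\ 𝒞) ∪ (𝒞 \\ ℬ) ∪ (ℬ \\ ℬ))` is ineq-gen-3's `MS2′`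
(`OrderedDifferences.card_add_card_le_card_diffs_union`, p202786), whose hypothesis `univ∖a ⊄ ξ` is exactly co-intersection.  [this work]
-/

namespace Summit.CriticalPhenomena.PercolationContinuityZ3.Theorems.JBern

open Finset
open scoped FinsetFamily
open Summit.CriticalPhenomena.PercolationContinuityZ3.Theorems.SunflowerPartition.HallGladkov

variable {α : Type*} [Fintype α] [DecidableEq α]

/-- **Two petals, both orientations, co-intersecting families** (this work, via prim-ineq-gen-3's `MS2′`).  `U₁, U₂` up-sets; `S` a family of sets `ζ` with
(`ζ ∈ U₁∖U₂`, `univ∖ζ ∈ U₂∖U₁`) or (`ζ ∈ U₂∖U₁`, `univ∖ζ ∈ U₁∖U₂`), pairwise CO-INTERSECTING (`ζ ∪ ξ ≠ univ`).  Then for every up-set `𝒰` the members of `S`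
in `𝒰` are at most as many as the targets `t ∈ 𝒰` (`t ∈ U₁ ∩ U₂`, `univ∖t ∉ U₁ ∪ U₂`). [this work] -/
theorem card_filter_le_card_filter_target_of_union_ne_univ (U₁ U₂ : Finset (Finset α))
    (hU₁ : IsUpperSet (U₁ : Set (Finset α))) (hU₂ : IsUpperSet (U₂ : Set (Finset α)))
    (S : Finset (Finset α))
    (hS : ∀ ζ ∈ S, (ζ ∈ U₁ ∧ ζ ∉ U₂ ∧ univ \ ζ ∈ U₂ ∧ univ \ ζ ∉ U₁) ∨ (ζ ∈ U₂ ∧ ζ ∉ U₁ ∧ univ \ ζ ∈ U₁ ∧ univ \ ζ ∉ U₂))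
    (hC : ∀ ζ ∈ S, ∀ ξ ∈ S, ζ ∪ ξ ≠ univ)
    (𝒰 : Finset (Finset α)) (h𝒰 : IsUpperSet (𝒰 : Set (Finset α))) :
    #(S.filter fun ζ => ζ ∈ 𝒰) ≤ #(𝒰.filter fun t => t ∈ U₁ ∧ t ∈ U₂ ∧ univ \ t ∉ U₁ ∧ univ \ t ∉ U₂) := by
  classical
  set A : Finset (Finset α) := (S.filter fun ζ => ζ ∈ 𝒰).filter (fun ζ => ζ ∈ U₁) with hAdef
  set B : Finset (Finset α) := (S.filter fun ζ => ζ ∈ 𝒰).filter (fun ζ => ζ ∉ U₁) with hBdef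
  set C : Finset (Finset α) := A.image (fun a => univ \ a) with hCdef
  have hmemA : ∀ a, a ∈ A ↔ (a ∈ S ∧ a ∈ 𝒰) ∧ a ∈ U₁ := fun a => by rw [hAdef, mem_filter, mem_filter]
  have hmemB : ∀ b, b ∈ B ↔ (b ∈ S ∧ b ∈ 𝒰) ∧ b ∉ U₁ := fun b => by rw [hBdef, mem_filter, mem_filter]
  have hmemC : ∀ c, c ∈ C ↔ ∃ a ∈ A, univ \ a = c := fun c => by rw [hCdef, mem_image]
  have htypeA : ∀ a ∈ A, a ∈ U₁ ∧ a ∉ U₂ ∧ univ \ a ∈ U₂ ∧ univ \ a ∉ U₁ := by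
    intro a ha
    obtain ⟨⟨haS, -⟩, ha1⟩ := (hmemA a).1 ha
    rcases hS a haS with h | h
    · exact h
    · exact absurd ha1 h.2.1
  have htypeB : ∀ b ∈ B, b ∈ U₂ ∧ b ∉ U₁ ∧ univ \ b ∈ U₁ ∧ univ \ b ∉ U₂ := by
    intro b hb
    obtain ⟨⟨hbS, -⟩, hb1⟩ := (hmemB b).1 hb
    rcases hS b hbS with h | h
    · exact absurd h.1 hb1
    · exact h
  -- #S' = #A + #B = #C + #B
  have hsplit : #(S.filter fun ζ => ζ ∈ 𝒰) = #A + #B := by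
    rw [hAdef, hBdef]; exact (card_filter_add_card_filter_not _).symm
  have hCA : #C = #A := by
    rw [hCdef]
    refine card_image_of_injOn fun a _ a' _ h => ?_
    have := congrArg (fun s => (univ : Finset α) \ s) h
    simpa only [univ_sdiff_univ_sdiff] using this
  -- MS2′
  have hMS : #C + #B ≤ #((C \\ C) ∪ (C \\ B) ∪ (B \\ B)) := by
    refine OrderedDifferences.card_add_card_le_card_diffs_union C B fun c hc b hb => ?_
    obtain ⟨a, ha, rfl⟩ := (hmemC c).1 hc
    have haS : a ∈ S := ((hmemA a).1 ha).1.1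
    have hbS : b ∈ S := ((hmemB b).1 hb).1.1
    exact not_univ_sdiff_subset_of_union_ne_univ (hC a haS b hbS)
  -- complements of the differences are targets in 𝒰
  have e1 : ∀ a a' : Finset α, (univ \ a) \ (univ \ a') = a' \ a := by
    intro a a'; ext x; simp only [mem_sdiff, mem_univ, true_and, not_not]; tauto
  have e2 : ∀ a b : Finset α, (univ \ a) \ b = univ \ (a ∪ b) := by
    intro a b; ext x; simp only [mem_sdiff, mem_univ, true_and, mem_union, not_or]
  have hgood : ∀ D ∈ (C \\ C) ∪ (C \\ B) ∪ (B \\ B),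
      univ \ D ∈ 𝒰.filter (fun t => t ∈ U₁ ∧ t ∈ U₂ ∧ univ \ t ∉ U₁ ∧ univ \ t ∉ U₂) := by
    intro D hD
    rw [mem_filter, univ_sdiff_univ_sdiff]
    rw [mem_union, mem_union] at hD
    rcases hD with (h | h) | h
    · -- D = (univ \ a) \ (univ \ a') = a' \ a ; complement ⊇ a, ⊇ univ \ a'
      rw [Finset.mem_diffs] at h
      obtain ⟨c, hc, c', hc', rfl⟩ := h
      obtain ⟨a, ha, rfl⟩ := (hmemC c).1 hc
      obtain ⟨a', ha', rfl⟩ := (hmemC c').1 hc'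
      have hta := htypeA a ha; have hta' := htypeA a' ha'
      have ha𝒰 : a ∈ 𝒰 := ((hmemA a).1 ha).1.2
      rw [e1]
      have hsub : a ⊆ univ \ (a' \ a) := fun x hx => mem_sdiff.2 ⟨mem_univ x, fun h => (mem_sdiff.1 h).2 hx⟩
      have hsub' : univ \ a' ⊆ univ \ (a' \ a) := fun x hx => mem_sdiff.2 ⟨mem_univ x, fun h => (mem_sdiff.1 hx).2 (mem_sdiff.1 h).1⟩
      have hD1 : a' \ a ⊆ univ \ a := fun x hx => mem_sdiff.2 ⟨mem_univ x, (mem_sdiff.1 hx).2⟩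
      have hD2 : a' \ a ⊆ a' := fun x hx => (mem_sdiff.1 hx).1
      exact ⟨h𝒰 hsub ha𝒰, hU₁ hsub hta.1, hU₂ hsub' hta'.2.2.1, fun h1 => hta.2.2.2 (hU₁ hD1 h1), fun h2 => hta'.2.1 (hU₂ hD2 h2)⟩
    · -- D = (univ \ a) \ ξ = univ \ (a ∪ ξ) ; complement a ∪ ξ
      rw [Finset.mem_diffs] at h
      obtain ⟨c, hc, b, hb, rfl⟩ := h
      obtain ⟨a, ha, rfl⟩ := (hmemC c).1 hc
      have hta := htypeA a ha; have htb := htypeB b hb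
      have ha𝒰 : a ∈ 𝒰 := ((hmemA a).1 ha).1.2
      rw [e2, univ_sdiff_univ_sdiff]
      have hD1 : univ \ (a ∪ b) ⊆ univ \ a := sdiff_subset_sdiff (subset_refl _) subset_union_left
      have hD2 : univ \ (a ∪ b) ⊆ univ \ b := sdiff_subset_sdiff (subset_refl _) subset_union_right
      exact ⟨h𝒰 subset_union_left ha𝒰, hU₁ subset_union_left hta.1, hU₂ subset_union_right htb.1,
        fun h1 => hta.2.2.2 (hU₁ hD1 h1), fun h2 => htb.2.2.2 (hU₂ hD2 h2)⟩
    · -- D = ξ \ ξ' ; complement ⊇ ξ', ⊇ univ \ ξ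
      rw [Finset.mem_diffs] at h
      obtain ⟨b, hb, b', hb', rfl⟩ := h
      have htb := htypeB b hb; have htb' := htypeB b' hb'
      have hb'𝒰 : b' ∈ 𝒰 := ((hmemB b').1 hb').1.2
      have hsub : b' ⊆ univ \ (b \ b') := fun x hx => mem_sdiff.2 ⟨mem_univ x, fun h => (mem_sdiff.1 h).2 hx⟩
      have hsub' : univ \ b ⊆ univ \ (b \ b') := sdiff_subset_sdiff (subset_refl _) sdiff_subset
      have hD1 : b \ b' ⊆ b := sdiff_subset
      have hD2 : b \ b' ⊆ univ \ b' := fun x hx => mem_sdiff.2 ⟨mem_univ x, (mem_sdiff.1 hx).2⟩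
      exact ⟨h𝒰 hsub hb'𝒰, hU₁ hsub' htb.2.2.1, hU₂ hsub htb'.1, fun h1 => htb.2.1 (hU₁ hD1 h1), fun h2 => htb'.2.2.2 (hU₂ hD2 h2)⟩
  -- assemble: complementation is injective
  calc #(S.filter fun ζ => ζ ∈ 𝒰) = #C + #B := by rw [hsplit, hCA]
    _ ≤ #((C \\ C) ∪ (C \\ B) ∪ (B \\ B)) := hMS
    _ ≤ #(𝒰.filter fun t => t ∈ U₁ ∧ t ∈ U₂ ∧ univ \ t ∉ U₁ ∧ univ \ t ∉ U₂) := by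
        refine Finset.card_le_card_of_injOn (fun D => univ \ D) (fun D hD => hgood D hD) fun D _ D' _ h => ?_
        have := congrArg (fun s => (univ : Finset α) \ s) h
        simpa only [univ_sdiff_univ_sdiff] using this

end Summit.CriticalPhenomena.PercolationContinuityZ3.Theorems.JBern
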